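import Summits.ResolutionOfSingularities.ResolutionOfSingularities.Theorems.SeparableGaloisGaloisQuotientModelsDefs
import Summits.ResolutionOfSingularities.ResolutionOfSingularities.Theorems.PAlterationPicoverBaseCase
import Literature.AlgebraicGeometry.RelativeSpec.FiniteGroupQuotientGluedProperties
import Literature.AlgebraicGeometry.RelativeSpec.FiniteGroupQuotientGenericEtale
import Literature.AlgebraicGeometry.Resolution.AlterationsProofs
import Literature.AlgebraicGeometry.Resolution.BirationalLocalIso
import Literature.AlgebraicGeometry.Resolution.BlowupRegularPoints
import Literature.AlgebraicGeometry.Resolution.RegularLocalRingsNormal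
import Mathlib.AlgebraicGeometry.ZariskisMainTheorem
import HarnessLib

/-!
# Crux `GaloisQuotientModels` (stmt-ResolutionOfSingularities-18955), line `inseparability-foliation-quotient`:
# stub `stub_quotientModel`

Route `ResolutionOfSingularities/SeparableGalois`; registered stub of the line skeleton
`Cruxes/GaloisQuotientModels/Lines/inseparability_foliation_quotient.lean` (lead's reshape, 2026-08-17).
Vocabulary: `Theorems/SeparableGaloisGaloisQuotientModelsDefs.lean`.

**Statement** (`stub_quotientModel`). Let `X` be an integral scheme, separated and of finite type
over a perfect field `k`, admitting a regular SEPARABLE Galois top (`HasSeparableGaloisTop X`): a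
`G`-invariant alteration `π' : X' → X` from a regular integral `X'` carrying a faithful action
`ρ' : G →* Aut X'` of a finite group, every finite subset of `X'` inside an affine open, and
`K(X')^G = π'♯ K(X)`. Then `GaloisQuotientConclusion X` holds: there is a proper birational
`π : X₁ → X`, `X₁` integral, presented as a Galois-type quotient `q : X' → X₁` (finite, surjective,
étale over a dense open, `G`-invariant, fibres = `G`-orbits) of the regular integral `X'`.

**Proof.** Take `X₁ := X'/G`, the glued quotient over `Spec k`
(`Literature.AlgebraicGeometry.RelativeSpec.ActionOver.glued`; it exists because every orbit lies in
an affine open, hence in a `G`-stable affine open, `exists_stableAffineOpen_le_of_orbit`), `q` the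
quotient map and `π := φ : X'/G → X` the morphism descended from the `G`-invariant `π'`. Exactly as
in `Theorems/WildQuotientsGaloisQuotientAlteration.lean`: `X'/G` is integral, `q` is finite,
surjective, `G`-invariant with fibres the orbits (Mumford, AV §7; SGA 1, V §1), étale over a
non-empty open because the faithful action is faithful on `K(X')`
(`exists_etale_morphismRestrict_gluedMk`), and `φ` is proper (`isProper_gluedDesc`). NEW here is the
BIRATIONALITY of `φ`: (i) `φ♯ : K(X) → K(X'/G)` is surjective — for `b ∈ K(X'/G)` the element
`q♯ b ∈ K(X')` is `G`-fixed (`g ≫ q = q`), so `q♯ b = π'♯ c = q♯ (φ♯ c)` by separability of the top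
and `π' = q ≫ φ`, whence `b = φ♯ c` — so `φ♯` is bijective and the stalk map of `φ` at the generic
point is an isomorphism; (ii) `φ` is finite over an open `V₁ ∋ η_X` (its fibre over `η_X` is the
image of `π'⁻¹(η_X) = {η_{X'}}`, `π'` being finite over a non-empty open; Zariski's Main Theorem in
the form Stacks 02UP, Mathlib `exists_isFinite_morphismRestrict_of_finite_preimage_singleton`);
(iii) the regular locus `V₀` of `X` is open (perfect fields are J-2,
`isOpen_regularLocus_of_locallyOfFiniteType_perfectField`), contains `η_X` (its local ring is the
field `K(X)`), and has integrally closed local rings (Matsumura, Thm. 19.4); (iv) over the normal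
open `W = V₁ ∩ V₀` the finite morphism `φ`, an isomorphism on function fields, is an isomorphism
(`isIso_of_isIntegralHom_of_normal`, de Jong 1996, proof of 4.20), and `W`, `φ⁻¹(W)` are non-empty
opens of irreducible spaces, hence dense.

Sources: A. J. de Jong, *Families of curves and alterations*, Ann. Inst. Fourier 47 (1997), 5.3,
Thm. 5.13, Cor. 5.15; A. J. de Jong, *Smoothness, semi-stability and alterations*, Publ. Math.
IHÉS 83 (1996), 2.20 and proof of Lemma 4.20; SGA 1, Exp. V, §1–2; D. Mumford, *Abelian
Varieties* (1970), §7; H. Matsumura, *Commutative Ring Theory*, Thm. 19.4; Stacks 02UP, 0AB1.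
No named facts are used: everything rests on proved tree material.
-/

noncomputable section

-- single-problem summit: the doubled namespace component `ResolutionOfSingularities` is forced
set_option linter.dupNamespace false

open CategoryTheory Limits AlgebraicGeometry TopologicalSpace
open Literature.AlgebraicGeometry.Resolution Literature.AlgebraicGeometry.RelativeSpec
open Literature.AlgebraicGeometry.Motives Literature.AlgebraicGeometry.Motives.RatFn

namespace Summit.ResolutionOfSingularities.ResolutionOfSingularities.Theorems.GaloisQuotientModels

open Summit.ResolutionOfSingularities.ResolutionOfSingularities.Theorems.Picover.BaseCase
  (isIso_stalkMap_genericPoint_of_bijective isIso_of_isIntegralHom_of_normal)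

/-- **Finite near the generic point + isomorphism on function fields + a normal open ⇒
birational** (de Jong 1996, proof of Lemma 4.20: "we may assume that `V` is normal. Thus the
finite birational morphism `pr₂⁻¹(V) → V` is an isomorphism"). Let `φ : Q → X` be a dominant
morphism of integral schemes whose stalk map at the generic point is an isomorphism, finite over
an open `V₁ ∋ η_X`, and let `V₀ ∋ η_X` be an open all of whose local rings are integrally closed.
Then `φ` is an isomorphism over the dense open `W = V₁ ∩ V₀`, whose preimage is dense, i.e. `φ`
is birational. [cite: DeJong1996, proof of Lemma 4.20, p. 73] -/
theorem isBirational_of_isFinite_morphismRestrict_of_isIso_stalkMap {Q X : Scheme.{0}}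
    [IsIntegral Q] [IsIntegral X] (φ : Q ⟶ X) [IsDominant φ]
    (hstalk : IsIso (φ.stalkMap (genericPoint Q))) (V₁ : X.Opens)
    (hηV₁ : genericPoint X ∈ V₁) [IsFinite (φ ∣_ V₁)] (V₀ : X.Opens) (hηV₀ : genericPoint X ∈ V₀)
    (hV₀ : ∀ x ∈ V₀, IsIntegrallyClosed (X.presheaf.stalk x)) : IsBirational φ := by
  let W : X.Opens := V₁ ⊓ V₀
  have hηW : genericPoint X ∈ W := ⟨hηV₁, hηV₀⟩
  haveI : IsFinite (φ ∣_ W) := isFinite_morphismRestrict_of_le φ inf_le_left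
  haveI : Nonempty W := ⟨⟨_, hηW⟩⟩
  haveI : IsDominant (φ ∣_ W) := IsZariskiLocalAtTarget.restrict ‹IsDominant φ› W
  haveI hne : Nonempty (φ ⁻¹ᵁ W) := nonempty_preimage_of_isDominant φ W
  haveI : IsIntegral (φ ⁻¹ᵁ W) := isIntegral_of_isOpenImmersion (φ ⁻¹ᵁ W).ι
  haveI : IsIntegral W := isIntegral_of_isOpenImmersion W.ι
  have hstalkW := isIso_stalkMap_morphismRestrict_genericPoint φ hstalk W
  have hiso : IsIso (φ ∣_ W) :=
    isIso_of_isIntegralHom_of_normal (φ ∣_ W) hstalkW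
      (isIntegrallyClosed_stalk_opens W fun x hx => hV₀ x hx.2)
  refine ⟨W, W.isOpen.dense ⟨_, hηW⟩, (φ ⁻¹ᵁ W).isOpen.dense ?_, hiso⟩
  obtain ⟨x⟩ := hne
  exact ⟨x.1, x.2⟩

/-- **The separable Galois top descends to a Galois quotient model** (de Jong 1997, 5.3 and
Cor. 5.15, separable case; quotients by finite groups after SGA 1, V §1–2 and Mumford, AV §7).
From a regular separable Galois top `π' : X' → X` (faithful finite `G`, `π'` a `G`-invariant
alteration, finite subsets of `X'` in affine opens, `K(X')^G = π'♯ K(X)`) over a perfect field: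
`X₁ := X'/G` (glued quotient over `Spec k`), `q : X' → X'/G` finite surjective `G`-invariant with
fibres the orbits and étale over a dense open (the action is faithful on `K(X')`), and the
descended `φ : X'/G → X` is proper and BIRATIONAL: `φ♯` is bijective because `G`-fixed rational
functions come from `K(X)`, `φ` is finite near the generic point (Stacks 02UP), the regular locus
of `X` is a non-empty normal open (J-2 + Matsumura 19.4), and a finite morphism which is an
isomorphism on function fields is an isomorphism over a normal open (de Jong 1996, 4.20).
[cite: DeJong1997, 5.3 and Cor. 5.15] -/
theorem stub_quotientModel (k : Type) [Field k] [PerfectField k] (X : Scheme.{0}) [IsIntegral X]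
    (f : X ⟶ Spec (.of k)) [IsSeparated f] [LocallyOfFiniteType f] [QuasiCompact f]
    (htop : HasSeparableGaloisTop X) : GaloisQuotientConclusion X := by
  classical
  obtain ⟨G, _, _, X', _, ρ, π, _, hπ, hreg, hρinj, hinv, hfinaff, hd⟩ := htop
  haveI : Fintype G := Fintype.ofFinite G
  haveI := hπ.isProper
  haveI : Surjective π := hπ.surjective
  haveI : X.IsSeparated := ⟨by rw [← terminal.comp_from f]; infer_instance⟩
  -- the action over `Spec k` and the covering by `G`-stable affine opens
  let r : X' ⟶ Spec (.of k) := π ≫ f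
  let ρA : ActionOver r G := ⟨ρ, fun g => by rw [← Category.assoc, hinv g]⟩
  haveI : IsSeparated r := inferInstanceAs (IsSeparated (π ≫ f))
  haveI : LocallyOfFiniteType r := inferInstanceAs (LocallyOfFiniteType (π ≫ f))
  haveI : QuasiCompact r := inferInstanceAs (QuasiCompact (π ≫ f))
  haveI : X'.IsSeparated := ⟨by rw [← terminal.comp_from r]; infer_instance⟩
  have hcov : ∀ x : X', ∃ O : ρA.StableAffineOpens, x ∈ O.1 := by
    intro x
    obtain ⟨U, hU, hS⟩ := hfinaff (Finset.univ.image fun g : G => (ρ g).hom x)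
    obtain ⟨O, hx, -⟩ := ρA.exists_stableAffineOpen_le_of_orbit x U hU fun g => hS (by
      simp only [Finset.coe_image, Finset.coe_univ, Set.image_univ, Set.mem_range]
      exact ⟨g, rfl⟩)
    exact ⟨O, hx⟩
  -- the quotient `X₁ := X'/G`, `q : X' → X₁`, `φ : X₁ → X`
  have hinv' : ∀ g : G, (ρA.aut g).hom ≫ π = π := hinv
  let q : X' ⟶ ρA.glued := ρA.gluedMk hcov
  let φ : ρA.glued ⟶ X := ρA.gluedDesc π hinv'
  have hqφ : q ≫ φ = π := ρA.gluedMk_gluedDesc hcov π hinv'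
  haveI : IsIntegral ρA.glued := ρA.isIntegral_glued hcov
  haveI : IsProper φ := ρA.isProper_gluedDesc hcov π hinv' f rfl
  haveI : Surjective φ := ρA.surjective_gluedDesc hcov π hinv'
  haveI : IsFinite q := ρA.isFinite_gluedMk hcov
  refine ⟨ρA.glued, X', φ, q, G, inferInstance, inferInstance, ρ, inferInstance, ?_, inferInstance,
    inferInstance, hreg, inferInstance, ρA.gluedMk_surjective hcov, ?_, ρA.aut_hom_gluedMk hcov,
    fun x y hxy => ρA.exists_aut_apply_eq_of_gluedMk_eq hcov hxy⟩
  · -- `φ` is birational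
    -- (i) `φ♯ : K(X) → K(X'/G)` is bijective: `G`-fixed rational functions come from `K(X)`
    have hsurj : Function.Surjective (functionFieldMap φ) := by
      intro b
      have hfix : ∀ g : G, functionFieldMap (ρ g).hom (functionFieldMap q b) =
          functionFieldMap q b := by
        intro g
        have key : ∀ (q' : X' ⟶ ρA.glued) [IsDominant q'], q' = q →
            functionFieldMap q' = functionFieldMap q := by
          rintro _ _ rfl; rfl
        have e : functionFieldMap ((ρ g).hom ≫ q) = (functionFieldMap (ρ g).hom).comp
            (functionFieldMap q) := functionFieldMap_comp q (ρ g).hom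
        rw [← RingHom.comp_apply, ← e, key ((ρ g).hom ≫ q) (ρA.aut_hom_gluedMk hcov g)]
      obtain ⟨c, hc⟩ := hd (functionFieldMap q b) hfix
      refine ⟨c, (functionFieldMap q).injective ?_⟩
      have key : ∀ (π' : X' ⟶ X) [IsDominant π'], π' = π →
          functionFieldMap π' = functionFieldMap π := by
        rintro _ _ rfl; rfl
      rw [← hc, ← key (q ≫ φ) hqφ, functionFieldMap_comp φ q, RingHom.comp_apply]
    have hstalk : IsIso (φ.stalkMap (genericPoint ρA.glued)) :=
      isIso_stalkMap_genericPoint_of_bijective φ ⟨(functionFieldMap φ).injective, hsurj⟩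
    -- (ii) `φ` is finite over a neighbourhood of the generic point `η`: its fibre there is finite
    obtain ⟨U₀, hU₀ne, hU₀fin⟩ := hπ.exists_isFinite
    haveI := hU₀fin
    have hη₀ : genericPoint X ∈ U₀ :=
      ((genericPoint_spec X).mem_open_set_iff U₀.isOpen).mpr (by simpa using hU₀ne)
    have hfib : (φ ⁻¹' {genericPoint X}).Finite := by
      refine ((Set.finite_singleton (genericPoint X')).image q).subset ?_
      intro y hy
      obtain ⟨x, rfl⟩ := ρA.gluedMk_surjective hcov y
      have hx : π x = genericPoint X := by
        rw [← hqφ]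
        exact hy
      refine ⟨x, ?_, rfl⟩
      exact eq_genericPoint_of_isFinite_restrict π U₀ (by show π x ∈ U₀; rw [hx]; exact hη₀) hx
    obtain ⟨V₁, hηV₁, hV₁fin⟩ :=
      exists_isFinite_morphismRestrict_of_finite_preimage_singleton φ (genericPoint X) hfib
    haveI := hV₁fin
    -- (iii) the regular locus of `X` is a normal open containing `η`
    let V₀ : X.Opens :=
      ⟨Scheme.regularLocus X, isOpen_regularLocus_of_locallyOfFiniteType_perfectField f⟩
    have hηV₀ : genericPoint X ∈ V₀ :=
      show IsRegularLocalRing X.functionField from inferInstance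
    have hV₀ : ∀ x ∈ V₀, IsIntegrallyClosed (X.presheaf.stalk x) := fun x hx =>
      haveI : IsRegularLocalRing (X.presheaf.stalk x) := hx
      isIntegrallyClosed_of_isRegularLocalRing _
    -- (iv) finite + isomorphism on function fields over the normal open `V₁ ∩ V₀`
    exact isBirational_of_isFinite_morphismRestrict_of_isIso_stalkMap φ hstalk V₁ hηV₁ V₀ hηV₀ hV₀
  · -- `q` is étale over a dense open: the action is faithful on `K(X')`
    have hfaith : ∀ g : G, g ≠ 1 → functionFieldMap (ρA.aut g).hom ≠ RingHom.id _ :=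
      ρA.functionFieldMap_ne_id_of_injective hρinj
    obtain ⟨U, hUne, hU⟩ := ρA.exists_etale_morphismRestrict_gluedMk hcov hfaith
    exact ⟨U, U.isOpen.dense hUne, hU⟩

end Summit.ResolutionOfSingularities.ResolutionOfSingularities.Theorems.GaloisQuotientModels

end
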